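import Summits.CriticalPhenomena.SAWScalingLimit.Theses.SAWCompassLattice
import Summits.CriticalPhenomena.SAWScalingLimit.Theses.SAWParafermion
import Summits.CriticalPhenomena.SAWScalingLimit.Theses.SAWTrackTransport
import Summits.CriticalPhenomena.SAWScalingLimit.Theorems.SAWDevelopingMapHexTransferLineReduction
import Summits.CriticalPhenomena.SAWScalingLimit.Theorems.SAWCompassLatticeSurfaceUniversalityNonVacuity
import Summits.CriticalPhenomena.SAWScalingLimit.Theorems.SAWCompassLatticeCompassSLEYbCriterion
import Summits.CriticalPhenomena.SAWScalingLimit.Theorems.SubseqIdentification.Negative.ProbabilityRedundant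
import Literature.Probability.RandomPlanarGeometry.SLEConvergenceCriterion
import Literature.Probability.RandomPlanarGeometry.PortGadgetLattice
import Mathlib.MeasureTheory.Measure.Portmanteau

/-!
# One-sided Prokhorov upgrade, Lipschitz port coupling and the tight toll reduction for the crux
# `SurfaceUniversality` (stmt-CriticalPhenomena-6964) — line `registered` (lead c1), `--supports`

Route `SAWCompassLattice` (sub-problem `SAWScalingLimit`), crux `SurfaceUniversality`: the critical
`ℤ²` SAW law `SAW.law` and the compass chordal law `SAW.compassLaw` merge on ALL bounded continuous
test functions of `CurveClass ℂ` as `δ → 0⁺` (`Surface.surfaceUniversality_iff`, `Iff.rfl`).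

This file lands the sorry-free analytic spine of the lead's reshaped skeleton
(`Cruxes/SurfaceUniversality/Lines/birth.lean`, cycle 1; first written by the crux strategist in
`Cruxes/SurfaceUniversality/TightToll.lean`):

* `tendsto_sub_of_isTightAlongMesh` — **one-sided Prokhorov upgrade**: if ONE of two families of
  laws on the Polish space `CurveClass ℂ` is tight along `δ → 0⁺` (`IsTightAlongMesh`) and the two
  merge on bounded LIPSCHITZ functions, they merge on all bounded continuous functions
  (subsequence principle + `IsTightAlongMesh.exists_subseq` + Mathlib's bounded-Lipschitz
  portmanteau `tendsto_iff_forall_lipschitz_integral_tendsto`); no tightness of the second family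
  is needed — its convergence along the extracted subsequence is read off the Lipschitz merging.
  This is WHY the line is cut at bounded-Lipschitz level: on the non-compact `CurveClass ℂ` a
  deterministic `O(δ)` coupling gives Lipschitz merging for free but never `C_b` merging.
* `norm_integral_yb_sub_compass_le`, `lipPortCoupling` — **the proved leg**: for a solution of the
  compass equations, `‖∫ f∘curve d ybLaw(π/2) − ∫ f d compassLaw‖ ≤ L·|δ|` for bounded `L`-Lipschitz
  `f` (landed port dictionary `Sketch.stub_portDictionary`, landed push-forward identities
  `PortTransfer.ybLaw_eq_map` / `compassLaw_eq_map`, landed drawing coupling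
  `PortTransfer.dist_compassCurve_curve_le`): no limit, no tightness, every domain, every ports.
* `surfaceUniversality_of_tight_of_lipMerge` — **the composition of the line**: eventual tightness
  of the `ℤ²` walk (`SAWParafermion.EventualTight`, item stmt-CriticalPhenomena-1881) and
  bounded-Lipschitz merging of `SAW.law` with GM's `ybLaw (π/2)` give the crux BY NAME; and its
  item-level corollary `surfaceUniversality_of_tight_of_ybToUniform :
  EventualTight → SAWTrackTransport.YBtoUniform → SurfaceUniversality` (stmt-1881 → stmt-16966 →
  stmt-6964), the toll reduction WITHOUT `YBSquareSLE` (compare the sibling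
  `…SurfaceUniversalityTollReduction.lean`: `YBSquareSLE → YBtoUniform → SurfaceUniversality`).

Also here, for the sibling crux `SAWTrackTransport.YBtoUniform` (stmt-CriticalPhenomena-16966,
whose birth skeleton is aligned with this line): `ybToUniform_of_tight_of_lipMerge`,
`ybToUniform_iff_lip_of_tight` — the same one-sided upgrade with the YB law pushed to the curve
space, so one Lipschitz-merging proof closes both cruxes modulo stmt-1881.

Deliberately NOT here: the line's stub statements `LipPlusPointIsZ2`, `LipPlusToYB` and the named
plus law (`…SurfaceUniversalityDefs.lean`, reviewed definitions); the stubs themselves (open).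
-/

noncomputable section

namespace Summit.CriticalPhenomena.SAWScalingLimit.Theorems.SurfaceUniversality

open MeasureTheory Filter Topology Set
open scoped NNReal ENNReal BoundedContinuousFunction
open Literature.Probability.RandomPlanarGeometry
open Literature.Probability.RandomPlanarGeometry.SAW
open Literature.Probability.RandomPlanarGeometry.SAW.YangBaxter
open Literature.Probability.LatticeModels (Site)
open Summit.CriticalPhenomena.SAWScalingLimit.Theses
open Summit.CriticalPhenomena.SAWScalingLimit.Cruxes.HexTransfer.Sketch

/-! ### Generic: one-sided tightness upgrades bounded-Lipschitz merging to `C_b` merging -/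

section Generic

variable {Ω : ℝ → Type*} [∀ δ, MeasurableSpace (Ω δ)]

/-- **One-sided Prokhorov upgrade.** Let `Y δ : Ω δ → CurveClass ℂ` be random curve classes under
laws `P δ` (probability measures making `Y δ` a.e.-measurable for small `δ`) forming a TIGHT family
along `δ → 0⁺`, and let `ν δ` be probability measures on `CurveClass ℂ` for small `δ` (NO tightness
assumed). If `E[g(Y δ)] − ∫ g dν δ → 0` for every bounded Lipschitz `g`, then
`E[f(Y δ)] − ∫ f dν δ → 0` for every bounded continuous `f`. Proof: by the subsequence principle
it suffices to extract, from every sequence of meshes `s n → 0⁺`, a subsequence along which the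
difference tends to `0`; Prokhorov along the mesh gives a subsequence with `Y ⇒ μ`; then `ν ⇒ μ`
on bounded Lipschitz functions, hence weakly (bounded-Lipschitz portmanteau), hence on `f`.
[cite: BillingsleyCPM1999, Thm. 5.1 and Thm. 2.6] -/
theorem tendsto_sub_of_isTightAlongMesh {Y : ∀ δ, Ω δ → CurveClass ℂ} {P : ∀ δ, Measure (Ω δ)}
    {ν : ℝ → Measure (CurveClass ℂ)}
    (hP : ∀ᶠ δ in 𝓝[>] (0 : ℝ), IsProbabilityMeasure (P δ))
    (hY : ∀ᶠ δ in 𝓝[>] (0 : ℝ), AEMeasurable (Y δ) (P δ))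
    (hT : IsTightAlongMesh Y P)
    (hν : ∀ᶠ δ in 𝓝[>] (0 : ℝ), IsProbabilityMeasure (ν δ))
    (hLip : ∀ (g : CurveClass ℂ →ᵇ ℝ) (L : ℝ≥0), LipschitzWith L g →
      Tendsto (fun δ => (∫ ω, g (Y δ ω) ∂P δ) - ∫ x, g x ∂ν δ) (𝓝[>] (0 : ℝ)) (𝓝 0))
    (f : CurveClass ℂ →ᵇ ℝ) :
    Tendsto (fun δ => (∫ ω, f (Y δ ω) ∂P δ) - ∫ x, f x ∂ν δ) (𝓝[>] (0 : ℝ)) (𝓝 0) := by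
  classical
  -- surrogate probability laws on the curve space, equal to the push-forward laws for small `δ`
  obtain ⟨ρ, hρ⟩ : ∃ ρ : ℝ → Measure (CurveClass ℂ), ∀ δ, ρ δ =
      if IsProbabilityMeasure ((P δ).map (Y δ)) then (P δ).map (Y δ)
      else Measure.dirac (CurveClass.mk (Curve.const 0)) :=
    ⟨_, fun _ => rfl⟩
  have hρprob : ∀ δ, IsProbabilityMeasure (ρ δ) := by
    intro δ
    by_cases h : IsProbabilityMeasure ((P δ).map (Y δ))
    · rw [hρ δ, if_pos h]
      exact h
    · rw [hρ δ, if_neg h]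
      infer_instance
  have hev : ∀ᶠ δ in 𝓝[>] (0 : ℝ), AEMeasurable (Y δ) (P δ) ∧ ρ δ = (P δ).map (Y δ) := by
    filter_upwards [hP, hY] with δ hPδ hYδ
    haveI := hPδ
    refine ⟨hYδ, ?_⟩
    rw [hρ δ, if_pos (Measure.isProbabilityMeasure_map hYδ)]
  have hTρ : IsTightAlongMesh (Ωδ := fun _ : ℝ => CurveClass ℂ)
      (fun (_ : ℝ) (x : CurveClass ℂ) => x) ρ := by
    intro ε hε
    obtain ⟨K, hK, hb⟩ := hT ε hε
    refine ⟨K, hK, ?_⟩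
    filter_upwards [hb, hev] with δ hδ hδ'
    have hpre : (fun x : CurveClass ℂ => x) ⁻¹' Kᶜ = Kᶜ := rfl
    rw [hpre, hδ'.2,
      Measure.map_apply_of_aemeasurable hδ'.1 hK.isClosed.isOpen_compl.measurableSet]
    exact hδ
  haveI : ∀ δ, IsProbabilityMeasure (ρ δ) := hρprob
  refine tendsto_of_subseq_tendsto fun s hs => ?_
  obtain ⟨φ, μ, hφ, hμ, hlim⟩ :=
    hTρ.exists_subseq (Filter.Eventually.of_forall fun δ => aemeasurable_id') hs
  refine ⟨φ, ?_⟩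
  have ht : Tendsto (fun n => s (φ n)) atTop (𝓝[>] (0 : ℝ)) := hs.comp hφ.tendsto_atTop
  -- (i) the tight side converges to `μ` along `s ∘ φ`, on every bounded continuous function
  have hA : ∀ g : CurveClass ℂ →ᵇ ℝ,
      Tendsto (fun n => ∫ ω, g (Y (s (φ n)) ω) ∂P (s (φ n))) atTop (𝓝 (∫ x, g x ∂μ)) := by
    intro g
    refine (hlim g).congr' ?_
    filter_upwards [ht.eventually hev] with n hn
    change ∫ x, g x ∂ρ (s (φ n)) = _
    rw [hn.2, integral_map hn.1 g.continuous.aestronglyMeasurable]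
  -- (ii) the other side converges to `μ` along `s ∘ φ`, on bounded Lipschitz functions
  have hB : ∀ (g : CurveClass ℂ →ᵇ ℝ) (L : ℝ≥0), LipschitzWith L g →
      Tendsto (fun n => ∫ x, g x ∂ν (s (φ n))) atTop (𝓝 (∫ x, g x ∂μ)) := by
    intro g L hL
    have h1 : Tendsto (fun n => (∫ ω, g (Y (s (φ n)) ω) ∂P (s (φ n))) - ∫ x, g x ∂ν (s (φ n)))
        atTop (𝓝 0) := (hLip g L hL).comp ht
    have h2 := (hA g).sub h1
    rw [sub_zero] at h2
    exact h2.congr fun n => sub_sub_cancel _ _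
  -- (iii) surrogate probability measures on the `ν` side; bounded-Lipschitz portmanteau
  let ν' : ℕ → ProbabilityMeasure (CurveClass ℂ) := fun n =>
    if h : IsProbabilityMeasure (ν (s (φ n))) then ⟨ν (s (φ n)), h⟩ else ⟨μ, hμ⟩
  have hν' : ∀ᶠ n in atTop, ((ν' n : ProbabilityMeasure (CurveClass ℂ)) : Measure (CurveClass ℂ))
      = ν (s (φ n)) := by
    filter_upwards [ht.eventually hν] with n hn
    show ((if h : IsProbabilityMeasure (ν (s (φ n))) then (⟨ν (s (φ n)), h⟩ : ProbabilityMeasure _)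
      else ⟨μ, hμ⟩ : ProbabilityMeasure (CurveClass ℂ)) : Measure (CurveClass ℂ)) = _
    rw [dif_pos hn]
    rfl
  have hweak : Tendsto ν' atTop (𝓝 (⟨μ, hμ⟩ : ProbabilityMeasure (CurveClass ℂ))) := by
    refine tendsto_iff_forall_lipschitz_integral_tendsto.2 fun g hgb hgl => ?_
    obtain ⟨L, hL⟩ := hgl
    let gb : CurveClass ℂ →ᵇ ℝ := ⟨⟨g, hL.continuous⟩, hgb⟩
    refine ((hB gb L hL).congr' ?_)
    filter_upwards [hν'] with n hn
    rw [hn]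
    rfl
  -- (iv) hence on `f`, and the difference tends to `∫ f dμ - ∫ f dμ = 0`
  have hC : Tendsto (fun n => ∫ x, f x ∂ν (s (φ n))) atTop (𝓝 (∫ x, f x ∂μ)) := by
    have h := (ProbabilityMeasure.tendsto_iff_forall_integral_tendsto.1 hweak) f
    refine h.congr' ?_
    filter_upwards [hν'] with n hn
    rw [hn]
  have h := (hA f).sub hC
  rwa [sub_self] at h

end Generic

/-! ### The proved leg: GM's Yang–Baxter law vs the compass law, on bounded Lipschitz functions -/

/-- **Port coupling at bounded-Lipschitz level, as an inequality.** For a solution of the compass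
equations, any domain `Ω`, mesh `δ`, ports `a, b` and a bounded `L`-Lipschitz `f`:
`‖∫ f (γ.curve) d ybLaw(π/2) Ω δ 1 a b − ∫ f d compassLaw α β s z Ω δ a b‖ ≤ L · |δ|`. Both laws are
push-forwards of ONE normalised compass path measure `ρ_δ` (landed `PortTransfer.ybLaw_eq_map`,
through the landed port dictionary `Sketch.stub_portDictionary`, and `PortTransfer.compassLaw_eq_map`)
along two drawings at distance `≤ |δ|` (`PortTransfer.dist_compassCurve_curve_le`); `ρ_δ` is `0`
or a probability measure. No limit, no tightness. [folklore] -/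
theorem norm_integral_yb_sub_compass_le {α β s z : ℝ} (hsol : IsCompassSolution α β s z)
    (Ω : Set ℂ) (δ : ℝ) (a b : MidEdge) (f : CurveClass ℂ →ᵇ ℝ) {L : ℝ≥0}
    (hf : LipschitzWith L f) :
    ‖(∫ γ, f (γ.curve rightAngles δ) ∂(ybLaw rightAngles Ω δ 1 a b)) -
        ∫ x, f x ∂(SAW.compassLaw α β s z Ω δ a b)‖ ≤ L * |δ| := by
  have hP : SAWCompassLattice.PortDictionary :=
    Summit.CriticalPhenomena.SAWScalingLimit.Cruxes.HexTransfer.Sketch.stub_portDictionary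
  have h1 : ∫ γ, f (γ.curve rightAngles δ) ∂(ybLaw rightAngles Ω δ 1 a b) =
      ∫ p, f ((PortTransfer.toYB hP hsol p).curve rightAngles δ)
        ∂(PortTransfer.compassRho α β s z Ω δ a b) := by
    change ∫ γ, f (γ.curve (fun (_ : ℤ) => Real.pi / 2) δ)
        ∂(ybLaw (fun (_ : ℤ) => Real.pi / 2) Ω δ 1 a b) = _
    rw [PortTransfer.ybLaw_eq_map hP hsol,
      integral_map (PortTransfer.measurable_cpath _).aemeasurable]
    exact (YBWalk.measurable_of_top _).aestronglyMeasurable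
  have h2 : ∫ x, f x ∂(SAW.compassLaw α β s z Ω δ a b) =
      ∫ p, f (PortTransfer.compassCurve δ p) ∂(PortTransfer.compassRho α β s z Ω δ a b) := by
    change ∫ x, f x ∂(PortTransfer.compassLaw α β s z Ω δ a b) = _
    rw [PortTransfer.compassLaw_eq_map,
      integral_map (PortTransfer.measurable_cpath _).aemeasurable f.continuous.aestronglyMeasurable]
  rw [h1, h2, ← norm_neg, neg_sub]
  have key := PortTransfer.norm_integral_sub_integral_le (ε := |δ|)
    (PortTransfer.compassRho_zero_or_prob α β s z Ω δ a b)
    (PortTransfer.measurable_cpath _).aemeasurable (PortTransfer.measurable_cpath _).aemeasurable f hf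
    (fun p => PortTransfer.dist_compassCurve_curve_le p (PortTransfer.toYB hP hsol p)
      (PortTransfer.toYB_mids hP hsol p))
  rwa [abs_abs] at key

/-- **The proved leg along `δ → 0⁺`**: GM's critical square-tiling law and the compass chordal law
merge on bounded Lipschitz test functions, for every solution of the compass equations, EVERY
domain and EVERY family of ports (no endpoint approximation, no limit, no tightness). [folklore] -/
theorem lipPortCoupling {α β s z : ℝ} (hsol : IsCompassSolution α β s z) (Ω : Set ℂ)
    (a b : ℝ → MidEdge) (f : CurveClass ℂ →ᵇ ℝ) {L : ℝ≥0} (hf : LipschitzWith L f) :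
    Tendsto (fun δ : ℝ => (∫ γ, f (γ.curve rightAngles δ) ∂(ybLaw rightAngles Ω δ 1 (a δ) (b δ))) -
        ∫ x, f x ∂(SAW.compassLaw α β s z Ω δ (a δ) (b δ))) (𝓝[>] (0 : ℝ)) (𝓝 0) := by
  have hε : Tendsto (fun δ : ℝ => (L : ℝ) * |δ|) (𝓝[>] (0 : ℝ)) (𝓝 0) := by
    have h0 : Tendsto (fun δ : ℝ => |δ|) (𝓝[>] (0 : ℝ)) (𝓝 0) :=
      (continuous_abs.tendsto' (0 : ℝ) 0 abs_zero).mono_left nhdsWithin_le_nhds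
    simpa using (tendsto_const_nhds (x := (L : ℝ))).mul h0
  exact squeeze_zero_norm (fun δ => norm_integral_yb_sub_compass_le hsol Ω δ (a δ) (b δ) f hf) hε

/-! ### The composition of the line and the tight toll reduction -/

/-- **The composition of the reshaped line** (`EventualTight` + bounded-Lipschitz merging of the
`ℤ²` law with GM's square-tiling law `⇒` the crux, BY NAME): the one-sided Prokhorov upgrade
`tendsto_sub_of_isTightAlongMesh` applied to the tight `ℤ²` side (`SAW.law` is a probability measure
for small `δ`, `SubseqIdentification.Negative.eventually_isProbabilityMeasure_law`; the curve
observable is measurable) and the compass side (a probability measure for small `δ`,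
`Surface.eventually_isProbabilityMeasure_compassLaw_of_isCompassSolution`), the Lipschitz merging
`ℤ² ↔ compass` being `(∫dP^{ℤ²} − ∫dYB) + (∫dYB − ∫dCompass)` with the proved `lipPortCoupling`.
The hypothesis `hU` is `SAWTrackTransport.YBtoUniform` (stmt-16966) restricted to bounded Lipschitz
test functions; the line cuts it further at the plus point (`LipPlusPointIsZ2 + LipPlusToYB`). -/
theorem surfaceUniversality_of_tight_of_lipMerge (hT : SAWParafermion.EventualTight)
    (hU : ∀ (D : DobrushinDomain) (a b : ℝ → Site 2) (a' b' : ℝ → MidEdge),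
      SAW.IsEndpointApprox D a b → IsYBEndpointApprox rightAngles D a' b' →
      ∀ (f : BoundedContinuousFunction (CurveClass ℂ) ℝ) (L : ℝ≥0), LipschitzWith L f →
        Tendsto (fun δ : ℝ => (∫ γ, f γ.curve ∂(SAW.law D.carrier δ (a δ) (b δ))) -
            ∫ γ, f (γ.curve rightAngles δ) ∂(ybLaw rightAngles D.carrier δ 1 (a' δ) (b' δ)))
          (𝓝[>] (0 : ℝ)) (𝓝 0)) :
    SAWCompassLattice.SurfaceUniversality := by
  refine Surface.surfaceUniversality_iff.2 ?_
  intro α β s z hsol D a b a' b' hab hab' f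
  refine tendsto_sub_of_isTightAlongMesh
    (Theorems.SubseqIdentification.Negative.eventually_isProbabilityMeasure_law hab)
    (Filter.Eventually.of_forall fun δ => SAW.aemeasurable_curve D.carrier δ (a δ) (b δ))
    (hT D a b hab)
    (Surface.eventually_isProbabilityMeasure_compassLaw_of_isCompassSolution hsol D hab')
    (fun g L hg => ?_) f
  have h := (hU D a b a' b' hab hab' g L hg).add (lipPortCoupling hsol D.carrier a' b' g hg)
  rw [add_zero] at h
  exact h.congr fun δ => sub_add_sub_cancel _ _ _

/-- **The tight toll reduction** (item level, no `YBSquareSLE`): eventual tightness of the critical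
`ℤ²` SAW (`SAWParafermion.EventualTight`, stmt-CriticalPhenomena-1881) and the `C_b` toll
`SAWTrackTransport.YBtoUniform` (stmt-CriticalPhenomena-16966) imply
`SAWCompassLattice.SurfaceUniversality` (stmt-CriticalPhenomena-6964). -/
theorem surfaceUniversality_of_tight_of_ybToUniform (hT : SAWParafermion.EventualTight)
    (hU : SAWTrackTransport.YBtoUniform) : SAWCompassLattice.SurfaceUniversality :=
  surfaceUniversality_of_tight_of_lipMerge hT fun D a b a' b' hab hab' f _ _ =>
    hU D a b a' b' hab hab' f


/-! ### The same composition for the sibling crux `YBtoUniform` (stmt-CriticalPhenomena-16966) -/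

/-- **`EventualTight` + bounded-Lipschitz merging of the `ℤ²` law with GM's square-tiling law `⇒`
`SAWTrackTransport.YBtoUniform` (stmt-CriticalPhenomena-16966), BY NAME** — the sibling crux whose
birth skeleton (`Cruxes/YBtoUniform/Lines/birth.lean`) is deliberately aligned with this line: the
one-sided Prokhorov upgrade with `ν δ :=` the push-forward of `ybLaw (π/2) D δ 1 a'_δ b'_δ` along
`YBWalk.curve` (a probability measure for small `δ`, `eventually_isProbabilityMeasure_ybLaw`, and
the curve is measurable on the discrete walk space). So ONE proof of the Lipschitz merging `hU`
closes both cruxes modulo the shared tightness item stmt-1881. -/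
theorem ybToUniform_of_tight_of_lipMerge (hT : SAWParafermion.EventualTight)
    (hU : ∀ (D : DobrushinDomain) (a b : ℝ → Site 2) (a' b' : ℝ → MidEdge),
      SAW.IsEndpointApprox D a b → IsYBEndpointApprox rightAngles D a' b' →
      ∀ (f : BoundedContinuousFunction (CurveClass ℂ) ℝ) (L : ℝ≥0), LipschitzWith L f →
        Tendsto (fun δ : ℝ => (∫ γ, f γ.curve ∂(SAW.law D.carrier δ (a δ) (b δ))) -
            ∫ γ, f (γ.curve rightAngles δ) ∂(ybLaw rightAngles D.carrier δ 1 (a' δ) (b' δ)))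
          (𝓝[>] (0 : ℝ)) (𝓝 0)) :
    SAWTrackTransport.YBtoUniform := by
  intro D a b a' b' hab hab' f
  -- the YB side as a family of laws on the curve space
  have hmap : ∀ (δ : ℝ) (g : CurveClass ℂ →ᵇ ℝ),
      ∫ x, g x ∂((ybLaw rightAngles D.carrier δ 1 (a' δ) (b' δ)).map
          (fun γ => γ.curve rightAngles δ)) =
        ∫ γ, g (γ.curve rightAngles δ) ∂(ybLaw rightAngles D.carrier δ 1 (a' δ) (b' δ)) :=
    fun δ g => integral_map (YBWalk.measurable_of_top _).aemeasurable
      g.continuous.aestronglyMeasurable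
  have hν : ∀ᶠ δ in 𝓝[>] (0 : ℝ), IsProbabilityMeasure
      ((ybLaw rightAngles D.carrier δ 1 (a' δ) (b' δ)).map (fun γ => γ.curve rightAngles δ)) := by
    filter_upwards [SAWCompassLatticeCompassSLE.eventually_isProbabilityMeasure_ybLaw D hab']
      with δ hδ
    exact Measure.isProbabilityMeasure_map (YBWalk.measurable_of_top _).aemeasurable
  have h := tendsto_sub_of_isTightAlongMesh
    (Theorems.SubseqIdentification.Negative.eventually_isProbabilityMeasure_law hab)
    (Filter.Eventually.of_forall fun δ => SAW.aemeasurable_curve D.carrier δ (a δ) (b δ))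
    (hT D a b hab) hν (fun g L hg => ?_) f
  · simpa only [hmap] using h
  · simpa only [hmap] using hU D a b a' b' hab hab' g L hg

/-- **The tight toll for the sibling crux** (item level): `EventualTight` (stmt-1881) upgrades the
Lipschitz restriction of `YBtoUniform` to `YBtoUniform` itself; in particular with
`surfaceUniversality_of_tight_of_ybToUniform`, given stmt-1881 the two cruxes stmt-6964 and
stmt-16966 both reduce to ONE bounded-Lipschitz merging statement. -/
theorem ybToUniform_iff_lip_of_tight (hT : SAWParafermion.EventualTight) :
    SAWTrackTransport.YBtoUniform ↔
      ∀ (D : DobrushinDomain) (a b : ℝ → Site 2) (a' b' : ℝ → MidEdge),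
        SAW.IsEndpointApprox D a b → IsYBEndpointApprox rightAngles D a' b' →
        ∀ (f : BoundedContinuousFunction (CurveClass ℂ) ℝ) (L : ℝ≥0), LipschitzWith L f →
          Tendsto (fun δ : ℝ => (∫ γ, f γ.curve ∂(SAW.law D.carrier δ (a δ) (b δ))) -
              ∫ γ, f (γ.curve rightAngles δ) ∂(ybLaw rightAngles D.carrier δ 1 (a' δ) (b' δ)))
            (𝓝[>] (0 : ℝ)) (𝓝 0) :=
  ⟨fun h D a b a' b' hab hab' f _ _ => h D a b a' b' hab hab' f,
    ybToUniform_of_tight_of_lipMerge hT⟩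

/-- Registered glue stub `tightToll` of the crux (one-line signature): the item-level tight toll
`EventualTight (1881) → YBtoUniform (16966) → SurfaceUniversality (6964)`. -/
theorem tightToll : SAWParafermion.EventualTight → SAWTrackTransport.YBtoUniform → SAWCompassLattice.SurfaceUniversality :=
  surfaceUniversality_of_tight_of_ybToUniform

end Summit.CriticalPhenomena.SAWScalingLimit.Theorems.SurfaceUniversality

end
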